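import Summits.Langlands.Langlands.Theorems.SoloBlindStrongPurity
import Literature.NumberTheory.Automorphic.PatrikisCMDescent
import Literature.NumberTheory.Automorphic.AlgebraicityTwist
import HarnessLib

/-!
# SoloBlindCMDescent — Patrikis's CM descent of the infinity type from Clozel's theorem alone

Solo seat `solo-Langlands-blind` (blind mode), session 3, sequel of `SoloBlindStrongPurity`.

The tree carries Patrikis 2019, Prop. 2.4.7 ("the infinity type of a regular algebraic cuspidal `π`
on `GL_n/F` descends to the maximal CM subfield `F_cm`") as the NAMED FACT
`Literature.NumberTheory.Automorphic.Patrikis2019_cmDescent`, and reduces it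
(`Patrikis2019_cmDescent_of_clozel`) to the vendored `Clozel1990_regularAlgebraic` PLUS two further
inputs — a model of `π_f` over `ℚ(π_f)` (`Aut(ℂ/ℚ(π_f)) ≤ heckeStabilizer π`) and strong
multiplicity one with archimedean components.  Here the fact is DISCHARGED from
`Clozel1990_regularAlgebraic` alone:

  `patrikis2019_cmDescent_of_clozel1990 : Clozel1990_regularAlgebraic → Patrikis2019_cmDescent`.

Route (purity of the conjugates instead of a rational model).  By `SoloBlind.stronglyPure_of_clozel1990`
(clauses (ii) conjugates + (iii) purity of the vendored fact) every infinity type `T` of a cuspidal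
regular algebraic `π` is *strongly pure*: `{a at γ⁻¹cγσ} = {w - a : a at σ}` for all `γ ∈ Aut(ℂ)`
and all `σ : F → ℂ`.  Applying this twice, the `a`-multisets of `T` are invariant under
`σ ↦ (g c g⁻¹ c) ∘ σ` for every `g ∈ Aut(ℂ)`, hence under the subgroup `N ≤ Aut(ℚ-alg ℂ)` generated
by the elements `g c g⁻¹ c` (`map_a_comp_eq_of_stronglyPure`).  `N` is normal, and Patrikis's
Galois-theoretic lemma — in the tree as
`Literature.NumberTheory.NumberFields.exists_algEquiv_apply_eq_of_forall_isCMField_or_isTotallyReal`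
for the group `Aut(ℂ/C₀)` — holds verbatim for ANY normal subgroup `Δ` containing the `g c g⁻¹ c`
(`exists_mem_apply_eq_of_forall_isCMField_or_isTotallyReal`; the proof is the tree's orbit-polynomial
argument with `Aut(ℂ/C₀)` replaced by `Δ`: the fixed points of `Δ` lie in
`C₀ = {z : g z̄ = \overline{g z} ∀ g}`, the orbit polynomial of `Δι` at a primitive element has
coefficients in `ιF ∩ C₀ = ι(F_cm)`, so `ι'`, agreeing with `ι` on `F_cm = ι⁻¹(C₀)` — a totally
real or CM subfield — is a root of it, i.e. lies in the orbit `Δι`).  Hence two embeddings agreeing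
on every CM-or-totally-real subfield have the same `a`-multisets
(`map_a_eq_of_stronglyPure`), for `F` of ANY signature (the fact's "totally imaginary" is not
used) and `T` regular C-algebraic; the L-algebraic case follows by the half-integral twist
(`CuspidalAutomorphicRepData.exists_twist_hasInfinityType`, `InfinityType.map_a_twist`), as in the
tree's reduction.  [cite: Patrikis2019, Prop. 2.4.7 and Rem. 2.4.8 (1) (arXiv:1207.6724 §3.2,
Prop. cmdescent)] [cite: Clozel1990, Thm. 3.13 and Lemme 4.9]
-/

noncomputable section

open scoped ComplexConjugate Cardinal Classical
open NumberField NumberField.ComplexEmbedding Polynomial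
open Literature.FieldTheory.AlgClosed Literature.NumberTheory.NumberFields
open Literature.NumberTheory.Automorphic

namespace Summit.Langlands.Langlands.Theorems
namespace SoloBlind

/-! ### Complex conjugation and the subgroup generated by the twisted double conjugations -/

/-- Complex conjugation as a `ℚ`-algebra automorphism of `ℂ`. -/
def conjAut : ℂ ≃ₐ[ℚ] ℂ := Complex.conjAe.restrictScalars ℚ

/-- `conjAut` acts as complex conjugation. -/
@[simp] theorem conjAut_apply (z : ℂ) : conjAut z = conj z := rfl

/-- The subgroup `N ≤ Aut(ℚ-alg ℂ)` generated by the products `(g c g⁻¹)(h c h⁻¹)` of two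
conjugates of complex conjugation `c` (equivalently, by the `g c g⁻¹ c`; this generating set is
visibly conjugation-stable). -/
def conjTwistSubgroup : Subgroup (ℂ ≃ₐ[ℚ] ℂ) :=
  Subgroup.closure (Set.range fun p : (ℂ ≃ₐ[ℚ] ℂ) × (ℂ ≃ₐ[ℚ] ℂ) =>
    p.1 * conjAut * p.1⁻¹ * (p.2 * conjAut * p.2⁻¹))

/-- The generators `(g c g⁻¹)(h c h⁻¹)` lie in `N`. -/
theorem conjTwist_mem_conjTwistSubgroup (g h : ℂ ≃ₐ[ℚ] ℂ) :
    g * conjAut * g⁻¹ * (h * conjAut * h⁻¹) ∈ conjTwistSubgroup :=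
  Subgroup.subset_closure ⟨(g, h), rfl⟩

/-- The twisted double conjugations `g c g⁻¹ c` lie in `N` (`h = 1`). -/
theorem conjTwist_one_mem_conjTwistSubgroup (g : ℂ ≃ₐ[ℚ] ℂ) :
    g * conjAut * g⁻¹ * conjAut ∈ conjTwistSubgroup := by
  have e : g * conjAut * g⁻¹ * conjAut = g * conjAut * g⁻¹ * (1 * conjAut * 1⁻¹) := by group
  rw [e]
  exact conjTwist_mem_conjTwistSubgroup g 1

/-- `N` is normal in `Aut(ℚ-alg ℂ)`: `k (g c g⁻¹)(h c h⁻¹) k⁻¹ = ((kg) c (kg)⁻¹)((kh) c (kh)⁻¹)`. -/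
theorem conjTwistSubgroup_conj_mem {δ : ℂ ≃ₐ[ℚ] ℂ} (hδ : δ ∈ conjTwistSubgroup)
    (k : ℂ ≃ₐ[ℚ] ℂ) : k * δ * k⁻¹ ∈ conjTwistSubgroup := by
  induction hδ using Subgroup.closure_induction with
  | mem x hx =>
    obtain ⟨⟨g, h⟩, rfl⟩ := hx
    have e : k * (g * conjAut * g⁻¹ * (h * conjAut * h⁻¹)) * k⁻¹ =
        (k * g) * conjAut * (k * g)⁻¹ * ((k * h) * conjAut * (k * h)⁻¹) := by group
    rw [e]
    exact conjTwist_mem_conjTwistSubgroup _ _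
  | one =>
    rw [mul_one, mul_inv_cancel]
    exact conjTwistSubgroup.one_mem
  | mul x y _ _ hx hy =>
    have e : k * (x * y) * k⁻¹ = (k * x * k⁻¹) * (k * y * k⁻¹) := by group
    rw [e]
    exact conjTwistSubgroup.mul_mem hx hy
  | inv x _ hx =>
    have e : k * x⁻¹ * k⁻¹ = (k * x * k⁻¹)⁻¹ := by group
    rw [e]
    exact conjTwistSubgroup.inv_mem hx

/-! ### Patrikis's transitivity lemma for an arbitrary normal subgroup containing the `g c g⁻¹ c` -/

/-- **Transitivity on the embeddings above `F_cm`, for any normal subgroup `Δ ∋ g c g⁻¹ c`.**  Let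
`Δ ≤ Aut(ℚ-alg ℂ)` be a subgroup containing `g c g⁻¹ c` for every `g` and stable under conjugation,
and let `ι ι' : F → ℂ` be embeddings of a number field agreeing on every subfield `M ≤ F` that is CM
or totally real.  Then `ι' = δ ∘ ι` for some `δ ∈ Δ`.  (The tree's
`exists_algEquiv_apply_eq_of_forall_isCMField_or_isTotallyReal` is the case `Δ = Aut(ℂ/C₀)`; the
proof is the same orbit-polynomial argument.) [cite: Patrikis2019, Prop. 2.4.7, proof
(arXiv:1207.6724 §3.2)] -/
theorem exists_mem_apply_eq_of_forall_isCMField_or_isTotallyReal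
    {F : Type} [Field F] [NumberField F] (Δ : Subgroup (ℂ ≃ₐ[ℚ] ℂ))
    (hΔc : ∀ g : ℂ ≃ₐ[ℚ] ℂ, g * conjAut * g⁻¹ * conjAut ∈ Δ)
    (hΔnormal : ∀ δ ∈ Δ, ∀ g : ℂ ≃ₐ[ℚ] ℂ, g * δ * g⁻¹ ∈ Δ) (ι ι' : F →+* ℂ)
    (hιι' : ∀ M : Subfield F, (IsCMField M ∨ IsTotallyReal M) → ∀ x ∈ M, ι x = ι' x) :
    ∃ δ ∈ Δ, ∀ x, δ (ι x) = ι' x := by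
  -- ring automorphisms of `ℂ` are `ℚ`-algebra automorphisms
  have toAlg : ∀ σ : ℂ ≃+* ℂ, ∃ g : ℂ ≃ₐ[ℚ] ℂ, ∀ z, g z = σ z := fun σ ↦
    ⟨AlgEquiv.ofRingEquiv (f := σ) fun q ↦ by simp, fun _ ↦ rfl⟩
  /- (1) The subfield `C₀` of `ℂ` where conjugation commutes with `Aut(ℂ)`; it is `Aut(ℂ)`-stable
  and contains the fixed points of `Δ`. -/
  obtain ⟨C₀, hC₀⟩ : ∃ C₀ : Subfield ℂ, ∀ z, z ∈ C₀ ↔ ∀ g : ℂ ≃ₐ[ℚ] ℂ, g (conj z) = conj (g z) :=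
    ⟨⨅ g : ℂ ≃ₐ[ℚ] ℂ, RingHom.eqLocusField ((g : ℂ →+* ℂ).comp (starRingEnd ℂ))
        ((starRingEnd ℂ).comp (g : ℂ →+* ℂ)),
      fun z ↦ by simp [Subfield.mem_iInf]⟩
  have hC₀g : ∀ z ∈ C₀, ∀ g : ℂ ≃ₐ[ℚ] ℂ, g z ∈ C₀ := fun z hz g ↦ (hC₀ _).mpr fun h ↦ by
    rw [← (hC₀ z).mp hz g, ← AlgEquiv.mul_apply, (hC₀ z).mp hz (h * g), AlgEquiv.mul_apply]
  have hC₀fix : ∀ w, (∀ δ ∈ Δ, δ w = w) → w ∈ C₀ := fun w hw ↦ (hC₀ w).mpr fun g ↦ by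
    have e := hw _ (hΔc g⁻¹)
    rw [inv_inv, AlgEquiv.mul_apply, AlgEquiv.mul_apply, AlgEquiv.mul_apply, conjAut_apply,
      conjAut_apply, AlgEquiv.aut_inv, AlgEquiv.symm_apply_eq] at e
    -- `e : conj (g (conj w)) = g w`
    have e2 := congrArg conj e
    rwa [Complex.conj_conj] at e2
  /- (2) The subfield `M = ι⁻¹(C₀)` of `F` (this is `F_cm`) is totally real or CM, so `ι = ι'`
  on `M`. -/
  set M : Subfield F := C₀.comap ι with hM_def
  have hM : ∀ x, x ∈ M ↔ ι x ∈ C₀ := fun x ↦ Subfield.mem_comap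
  have hMcm : IsTotallyReal M ∨ IsCMField M := by
    refine isTotallyReal_or_isCMField_of_conj_comm_apply (ι.comp M.subtype) fun σ x ↦ ?_
    obtain ⟨g, hg⟩ := toAlg σ
    have hx := (hC₀ _).mp ((hM x).mp x.2) g
    simpa [hg] using hx
  have hιM : ∀ x ∈ M, ι x = ι' x := hιι' M hMcm.symm
  /- (3) The `Δ`-orbit `B` of `ι` and its orbit polynomial `q` at a primitive element `θ`. -/
  let pb := Field.powerBasisOfFiniteOfSeparable ℚ F
  set B : Finset (F →+* ℂ) :=
    Finset.univ.filter fun ι₁ ↦ ∃ δ ∈ Δ, ι₁ = (δ : ℂ →+* ℂ).comp ι with hB_def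
  have hmemB : ∀ ι₁, ι₁ ∈ B ↔ ∃ δ ∈ Δ, ι₁ = (δ : ℂ →+* ℂ).comp ι := fun ι₁ ↦ by
    simp [hB_def]
  have hιB : ι ∈ B := (hmemB ι).mpr ⟨1, Δ.one_mem, RingHom.ext fun _ ↦ rfl⟩
  set q : ℂ[X] := ∏ ι₁ ∈ B, (X - C (ι₁ pb.gen)) with hq_def
  -- `q` is invariant under every automorphism of `ℂ` mapping `B` into itself
  have hqmap : ∀ g : ℂ ≃ₐ[ℚ] ℂ, (∀ ι₁ ∈ B, (g : ℂ →+* ℂ).comp ι₁ ∈ B) →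
      q.map (g : ℂ →+* ℂ) = q := by
    intro g hg
    have hinj : Set.InjOn (fun ι₁ : F →+* ℂ ↦ (g : ℂ →+* ℂ).comp ι₁) ↑B :=
      fun ι₁ _ ι₂ _ h ↦ RingHom.ext fun x ↦ g.injective (RingHom.congr_fun h x :)
    have himage : B.image (fun ι₁ : F →+* ℂ ↦ (g : ℂ →+* ℂ).comp ι₁) = B :=
      Finset.eq_of_subset_of_card_le (Finset.image_subset_iff.mpr hg)
        (Finset.card_image_of_injOn hinj).ge
    rw [hq_def, Polynomial.map_prod]
    conv_rhs => rw [← himage]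
    rw [Finset.prod_image hinj]
    refine Finset.prod_congr rfl fun ι₁ _ ↦ ?_
    simp only [Polynomial.map_sub, Polynomial.map_X, Polynomial.map_C, RingHom.comp_apply]
  -- in particular under `Δ` …
  have hqΔ : ∀ δ ∈ Δ, q.map (δ : ℂ →+* ℂ) = q := fun δ hδ ↦ hqmap δ fun ι₁ hι₁ ↦ by
    obtain ⟨δ', hδ', rfl⟩ := (hmemB ι₁).mp hι₁
    exact (hmemB _).mpr ⟨δ * δ', Δ.mul_mem hδ hδ', RingHom.ext fun _ ↦ rfl⟩
  -- … and under `Aut(ℂ/ιF)`, which permutes the orbit `B` because `Δ` is normal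
  have hqτ : ∀ τ : ℂ ≃ₐ[ℚ] ℂ, (∀ x, τ (ι x) = ι x) → q.map (τ : ℂ →+* ℂ) = q :=
      fun τ hτ ↦ hqmap τ fun ι₁ hι₁ ↦ by
    obtain ⟨δ', hδ', rfl⟩ := (hmemB ι₁).mp hι₁
    refine (hmemB _).mpr ⟨τ * δ' * τ⁻¹, hΔnormal δ' hδ' τ, RingHom.ext fun x ↦ ?_⟩
    have hτ' : τ⁻¹ (ι x) = ι x := by rw [AlgEquiv.aut_inv, AlgEquiv.symm_apply_eq, hτ]
    simp [AlgEquiv.mul_apply, hτ']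
  /- (4) Hence the coefficients of `q` lie in `ιF ∩ C₀ = ι(M)`: `q ∈ ι(M)[X]`. -/
  have hFc : #F ≤ ℵ₀ := (Algebra.IsAlgebraic.cardinalMk_le_max ℚ F).trans (by simp)
  have hιFc : #ι.fieldRange ≤ ℵ₀ :=
    (Cardinal.mk_le_of_surjective ι.rangeRestrictField_bijective.2).trans hFc
  have hcoeff : ∀ k, ∃ m ∈ M, q.coeff k = ι m := by
    intro k
    have h1 : q.coeff k ∈ ι.fieldRange := by
      refine Complex.mem_subfield_of_forall_ringEquiv ι.fieldRange hιFc fun σ hσ ↦ ?_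
      obtain ⟨τ, hτ⟩ := toAlg σ
      have hτι : ∀ x, τ (ι x) = ι x := fun x ↦ (hτ _).trans (hσ _ (ι.mem_fieldRange_self x))
      have h := congrArg (fun p : ℂ[X] ↦ p.coeff k) (hqτ τ hτι)
      simpa [Polynomial.coeff_map, hτ] using h
    obtain ⟨m, hm⟩ := RingHom.mem_fieldRange.mp h1
    have h2 : q.coeff k ∈ C₀ := hC₀fix _ fun δ hδ ↦ by
      have h := congrArg (fun p : ℂ[X] ↦ p.coeff k) (hqΔ δ hδ)
      simpa [Polynomial.coeff_map] using h
    refine ⟨m, ?_, hm.symm⟩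
    rw [hM, hm]
    exact h2
  obtain ⟨Q, hQ⟩ : ∃ Q : M[X], Q.map (ι.comp M.subtype) = q := by
    rw [← Polynomial.mem_lifts, Polynomial.lifts_iff_coeff_lifts]
    intro k
    obtain ⟨m, hm, hk⟩ := hcoeff k
    exact ⟨⟨m, hm⟩, hk.symm⟩
  /- (5) `q(ιθ) = 0`, hence (coefficients in `M`, where `ι = ι'`) `q(ι'θ) = 0`: `ι'θ = ι₁θ` for
  some `ι₁ ∈ Δι`, and `ι' = ι₁` since `θ` generates `F`. -/
  have hqι : q.eval (ι pb.gen) = 0 := by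
    rw [hq_def, Polynomial.eval_prod]
    exact Finset.prod_eq_zero hιB (by simp)
  have hQθ : Q.eval₂ M.subtype pb.gen = 0 := by
    apply ι.injective
    rw [Polynomial.hom_eval₂, map_zero, ← Polynomial.eval_map, hQ, hqι]
  have hqι' : q.eval (ι' pb.gen) = 0 := by
    have hcomp : ι'.comp M.subtype = ι.comp M.subtype :=
      RingHom.ext fun x ↦ (hιM x x.2).symm
    rw [← hQ, Polynomial.eval_map, ← hcomp, ← Polynomial.hom_eval₂, hQθ, map_zero]
  obtain ⟨ι₁, hι₁B, hι₁θ⟩ : ∃ ι₁ ∈ B, ι' pb.gen = ι₁ pb.gen := by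
    rw [hq_def, Polynomial.eval_prod, Finset.prod_eq_zero_iff] at hqι'
    obtain ⟨ι₁, hι₁, h0⟩ := hqι'
    exact ⟨ι₁, hι₁, by simpa [sub_eq_zero] using h0⟩
  have hιeq : ι' = ι₁ := by
    have h : ι'.toRatAlgHom = ι₁.toRatAlgHom := pb.algHom_ext (by simpa using hι₁θ)
    have h' := congrArg AlgHom.toRingHom h
    simpa [RingHom.toRatAlgHom_toRingHom] using h'
  obtain ⟨δ, hδ, rfl⟩ := (hmemB ι₁).mp hι₁B
  exact ⟨δ, hδ, fun x ↦ by rw [hιeq]; rfl⟩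

/-! ### Strong purity ⇒ invariance of the `a`-multisets under `N` ⇒ CM descent -/

section Descent

variable {F : Type} [Field F] {n : ℕ}

/-- **Strong purity makes the `a`-multisets `N`-invariant.**  If `T` is strongly pure of weight
`w` (`{a at γ⁻¹cγσ} = {w - a : a at σ}` for all `γ, σ`), then `{a at δ ∘ σ} = {a at σ}` for every
`δ` in the subgroup generated by the `g c g⁻¹ c`: for a generator,
`{a at g c g⁻¹ c σ} = {w - a : a at cσ} = {w - (w - a) : a at σ}`. -/
theorem map_a_comp_eq_of_stronglyPure (T : InfinityType F n) (w : ℂ)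
    (hT : ∀ (γ : ℂ ≃ₐ[ℚ] ℂ) (σ : F →+* ℂ),
      (T ((γ.symm : ℂ ≃ₐ[ℚ] ℂ).toAlgHom.toRingHom.comp
        ((starRingEnd ℂ).comp ((γ : ℂ ≃ₐ[ℚ] ℂ).toAlgHom.toRingHom.comp σ)))).map ArchWeight.a =
        ((T σ).map ArchWeight.a).map fun a => w - a)
    {δ : ℂ ≃ₐ[ℚ] ℂ} (hδ : δ ∈ conjTwistSubgroup) :
    ∀ σ : F →+* ℂ, (T ((δ : ℂ →+* ℂ).comp σ)).map ArchWeight.a = (T σ).map ArchWeight.a := by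
  induction hδ using Subgroup.closure_induction with
  | mem x hx =>
    obtain ⟨⟨g, h⟩, rfl⟩ := hx
    intro σ
    -- `{a at h c h⁻¹ σ} = {w - a : a at σ}` and `{a at g c g⁻¹ σ₁} = {w - a : a at σ₁}`
    have conjTwist_eq : ∀ (k : ℂ ≃ₐ[ℚ] ℂ) (ρ : F →+* ℂ),
        ((k⁻¹ : ℂ ≃ₐ[ℚ] ℂ).symm : ℂ ≃ₐ[ℚ] ℂ).toAlgHom.toRingHom.comp
          ((starRingEnd ℂ).comp ((k⁻¹ : ℂ ≃ₐ[ℚ] ℂ).toAlgHom.toRingHom.comp ρ)) =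
        ((k * conjAut * k⁻¹ : ℂ ≃ₐ[ℚ] ℂ) : ℂ →+* ℂ).comp ρ := fun k ρ => by
      refine RingHom.ext fun x => ?_
      change (k⁻¹ : ℂ ≃ₐ[ℚ] ℂ).symm (conj ((k⁻¹ : ℂ ≃ₐ[ℚ] ℂ) (ρ x))) =
        (k * conjAut * k⁻¹) (ρ x)
      rw [AlgEquiv.mul_apply, AlgEquiv.mul_apply, conjAut_apply, AlgEquiv.aut_inv,
        AlgEquiv.symm_symm]
    have h1 := hT h⁻¹ σ
    have h2 := hT g⁻¹ (((h * conjAut * h⁻¹ : ℂ ≃ₐ[ℚ] ℂ) : ℂ →+* ℂ).comp σ)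
    rw [conjTwist_eq] at h1 h2
    rw [h1, Multiset.map_map] at h2
    have e : ((g * conjAut * g⁻¹ * (h * conjAut * h⁻¹) : ℂ ≃ₐ[ℚ] ℂ) : ℂ →+* ℂ).comp σ =
        ((g * conjAut * g⁻¹ : ℂ ≃ₐ[ℚ] ℂ) : ℂ →+* ℂ).comp
          (((h * conjAut * h⁻¹ : ℂ ≃ₐ[ℚ] ℂ) : ℂ →+* ℂ).comp σ) := RingHom.ext fun _ => rfl
    rw [e, h2]
    conv_rhs => rw [← Multiset.map_id ((T σ).map ArchWeight.a)]
    refine Multiset.map_congr rfl fun a _ => ?_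
    simp
  | one =>
    intro σ
    rfl
  | mul x y _ _ hx hy =>
    intro σ
    have e : ((x * y : ℂ ≃ₐ[ℚ] ℂ) : ℂ →+* ℂ).comp σ =
        (x : ℂ →+* ℂ).comp ((y : ℂ →+* ℂ).comp σ) := RingHom.ext fun _ => rfl
    rw [e, hx, hy]
  | inv x _ hx =>
    intro σ
    have e : (x : ℂ →+* ℂ).comp (((x⁻¹ : ℂ ≃ₐ[ℚ] ℂ) : ℂ →+* ℂ).comp σ) = σ :=
      RingHom.ext fun z => by
        change x (x⁻¹ (σ z)) = σ z
        rw [← AlgEquiv.mul_apply, mul_inv_cancel, AlgEquiv.one_apply]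
    have h := hx (((x⁻¹ : ℂ ≃ₐ[ℚ] ℂ) : ℂ →+* ℂ).comp σ)
    rw [e] at h
    exact h.symm

/-- **CM descent of a strongly pure infinity type** (Patrikis 2019, Prop. 2.4.7, purity route).
If `T : InfinityType F n` over a number field `F` is strongly pure, then its `a`-multisets agree at
any two embeddings `ι ι'` that agree on every CM-or-totally-real subfield of `F` (i.e. on `F_cm`):
`ι' = δ ∘ ι` with `δ ∈ N` by the transitivity lemma, and the `a`-multisets are `N`-invariant.
[cite: Patrikis2019, Prop. 2.4.7 (arXiv:1207.6724 §3.2)] -/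
theorem map_a_eq_of_stronglyPure [NumberField F] (T : InfinityType F n) (w : ℂ)
    (hT : ∀ (γ : ℂ ≃ₐ[ℚ] ℂ) (σ : F →+* ℂ),
      (T ((γ.symm : ℂ ≃ₐ[ℚ] ℂ).toAlgHom.toRingHom.comp
        ((starRingEnd ℂ).comp ((γ : ℂ ≃ₐ[ℚ] ℂ).toAlgHom.toRingHom.comp σ)))).map ArchWeight.a =
        ((T σ).map ArchWeight.a).map fun a => w - a)
    {ι ι' : F →+* ℂ}
    (hιι' : ∀ M : Subfield F, (IsCMField M ∨ IsTotallyReal M) → ∀ x ∈ M, ι x = ι' x) :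
    (T ι).map ArchWeight.a = (T ι').map ArchWeight.a := by
  obtain ⟨δ, hδ, hδι⟩ := exists_mem_apply_eq_of_forall_isCMField_or_isTotallyReal
    conjTwistSubgroup conjTwist_one_mem_conjTwistSubgroup
    (fun δ hδ g => conjTwistSubgroup_conj_mem hδ g) ι ι' hιι'
  have e : (δ : ℂ →+* ℂ).comp ι = ι' := RingHom.ext hδι
  rw [← e, map_a_comp_eq_of_stronglyPure T w hT hδ ι]

end Descent

/-! ### The theorems: CM descent for regular algebraic cusp forms, and the named fact -/

section Main

variable {F : Type} [Field F] [NumberField F] {n : ℕ} {hcpt : isCompact_glFiniteIntegralLevel n F}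

/-- **CM descent of the infinity type of a regular algebraic cusp form, from Clozel's theorem**
(Patrikis 2019, Prop. 2.4.7 with Rem. 2.4.8 (1)).  Granted `Clozel1990_regularAlgebraic`: for `π`
cuspidal regular algebraic on `GL_n(𝔸_F)` over ANY number field `F` and `T` any infinity type of
`π`, the `a`-multisets of `T` agree at two embeddings agreeing on every CM-or-totally-real subfield
of `F`.  Inputs: strong purity (`stronglyPure_of_clozel1990`) and the transitivity lemma for the
subgroup `N`. [cite: Patrikis2019, Prop. 2.4.7 and Rem. 2.4.8 (1) (arXiv:1207.6724 §3.2)] -/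
theorem map_a_eq_of_isRegularAlgebraic (hC : Clozel1990_regularAlgebraic)
    (π : CuspidalAutomorphicRepData n F hcpt) (hπ : π.1.IsRegularAlgebraic)
    {T : InfinityType F n} (hT : π.1.HasInfinityType T) {ι ι' : F →+* ℂ}
    (hιι' : ∀ M : Subfield F, (IsCMField M ∨ IsTotallyReal M) → ∀ x ∈ M, ι x = ι' x) :
    (T ι).map ArchWeight.a = (T ι').map ArchWeight.a := by
  rcases Nat.eq_zero_or_pos n with hn | hn
  · subst hn
    have h0 : ∀ ι₀ : F →+* ℂ, T ι₀ = 0 := fun ι₀ ↦ Multiset.card_eq_zero.mp (hT.1.1 ι₀)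
    rw [h0 ι, h0 ι']
  · obtain ⟨w, hw⟩ := stronglyPure_of_clozel1990 hC hn.ne' π hπ hT
    exact map_a_eq_of_stronglyPure T (w : ℂ) hw hιι'

/-- **The same for `T` regular and C- or L-algebraic** (the L-algebraic case by the twist
`π ⊗ |det|^{-(n-1)/2}`, `CuspidalAutomorphicRepData.exists_twist_hasInfinityType` and
`InfinityType.map_a_twist`, "the L-algebraic analogue follows easily by twisting").
[cite: Patrikis2019, Prop. 2.4.7 and Rem. 2.4.8 (1) (arXiv:1207.6724 §3.2)] -/
theorem map_a_eq_of_isRegular_of_isAlgebraic (hC : Clozel1990_regularAlgebraic)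
    (π : CuspidalAutomorphicRepData n F hcpt) {T : InfinityType F n}
    (hT : π.1.HasInfinityType T) (hreg : T.IsRegular) (halg : T.IsCAlgebraic ∨ T.IsLAlgebraic)
    {ι ι' : F →+* ℂ}
    (hιι' : ∀ M : Subfield F, (IsCMField M ∨ IsTotallyReal M) → ∀ x ∈ M, ι x = ι' x) :
    (T ι).map ArchWeight.a = (T ι').map ArchWeight.a := by
  rcases halg with hCalg | hLalg
  · exact map_a_eq_of_isRegularAlgebraic hC π ⟨T, hT, hCalg, hreg⟩ hT hιι'
  · rcases Nat.eq_zero_or_pos n with hn | hn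
    · subst hn
      have h0 : ∀ ι₀ : F →+* ℂ, T ι₀ = 0 := fun ι₀ ↦ Multiset.card_eq_zero.mp (hT.1.1 ι₀)
      rw [h0 ι, h0 ι']
    · haveI : NeZero n := ⟨hn.ne'⟩
      obtain ⟨χ, π', -, -, -, hT'⟩ := π.exists_twist_hasInfinityType (-(((n : ℝ) - 1) / 2)) hT
      have hC' : (T.twist (((-(((n : ℝ) - 1) / 2) : ℝ) : ℂ))).IsCAlgebraic := by
        have e : (((-(((n : ℝ) - 1) / 2) : ℝ)) : ℂ) = -(((n : ℂ) - 1) / 2) := by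
          push_cast
          ring
        rw [e]
        exact (InfinityType.isLAlgebraic_iff_isCAlgebraic_twist T).mp hLalg
      have h := map_a_eq_of_isRegularAlgebraic hC π' ⟨_, hT', hC', hreg.twist _⟩ hT' hιι'
      rw [InfinityType.map_a_twist, InfinityType.map_a_twist] at h
      exact Multiset.map_injective (add_left_injective _) h

/-- **`Patrikis2019_cmDescent` holds granted `Clozel1990_regularAlgebraic` alone** — the tree's
named fact (Patrikis 2019, Prop. 2.4.7 with Rem. 2.4.8 (1)) discharged from the vendored Clozel
theorem by the purity route, without the model clause and strong multiplicity one required by the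
tree's `Patrikis2019_cmDescent_of_clozel`; the fact's hypothesis "`F` totally imaginary" is not used.
[cite: Patrikis2019, Prop. 2.4.7 and Rem. 2.4.8 (1) (arXiv:1207.6724 §3.2)]
[cite: Clozel1990, Thm. 3.13 and Lemme 4.9] -/
theorem patrikis2019_cmDescent_of_clozel1990 (hC : Clozel1990_regularAlgebraic) :
    Patrikis2019_cmDescent :=
  fun _F _ _ _ _n _hcpt π _T hT hreg halg _ι _ι' hιι' =>
    map_a_eq_of_isRegular_of_isAlgebraic hC π hT hreg halg hιι'

end Main

end SoloBlind
end Summit.Langlands.Langlands.Theorems
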